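import Literature.MathematicalPhysics.QuantumFieldTheory.Balaban1983to89.B9Thm311SmallFieldClosedUniform
import Literature.MathematicalPhysics.QuantumFieldTheory.Balaban1983to89.B9Eq3126H1Bound
import Literature.MathematicalPhysics.QuantumFieldTheory.Balaban1983to89.B9Eq315QFlatRightInverse

/-!
# `Balaban1983to89.B9Eq3126H1BoundUniform` — T. Bałaban, *Propagators for lattice gauge theories in a background field*, Commun. Math. Phys. **99**
# (1985) 389–434 [Balaban1985BackgroundPropagators] (3.126) p. 420, (3.153) p. 426 with Thm 3.4 p. 400 / Thm 3.11 p. 416: THE pub-balaban NE9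
# CHAIN'S `H₁(U) = G₁Q†(QG₁Q†)⁻¹` AND `𝔊(U) = G₁𝔓*` BOUNDED OVER THE SMALL FIELDS WITH CONSTANTS `C_H, C_G, ε₅` CHOSEN BEFORE THE VOLUME — the
# OWNER's `B9Eq3126H1Bound` with `∃` in front of `∀ m`

statement-level skeleton of published theorems with citation tags; proofs where landed; nothing here is a claim about the Yang–Mills mass gap

PDF held: `paper:balaban1985-cmp99-background-propagators` (journal page = PDF page + 388) pp. 400, 420, 426 read first-hand by this seat
(2026-08-22; p0012 L7–10, p0032 L30, p0038 L15–16).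

THE PRINT (verbatim).  p. 420, (3.126): *«HB = GQ*(QGQ*)⁻¹B»*; p. 426, (3.153): *«𝔊 = G₁ − G₁DRD*G₁ − G₁Q*(QG₁Q*)⁻¹QG₁ = G₁𝔓 …»*; p. 400: *«Theorem 3.4.
There exists a positive constant α₁ such that the operators G′(U), (Q′(U)G′²(U)Q′*(U))⁻¹, R(U), G(U) extend to configurations U′U for α₁′ ≤ α₁ as
analytic functions of A. The extended operators satisfy all the inequalities of Theorems 3.1–3.3 correspondingly.»*

WHY THIS FILE (cell context).  The OWNER g80's (H2) `B9Eq3126H1Bound.exists_H1_frakG_bound_of_small_field` (p317576) bounds the chain's `H₁(U)`,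
`𝔊(U)` uniformly over the small fields of ONE lattice; its HONEST SCOPE: «C_H, C_G, ε₅ depend on L, m, η, c₀, c₁».  The volume `m` enters through
exactly five tokens — `γ₁∕ε₃` ((F)-Green ← (E) ← (C2): the flat constant by compactness and the sup-to-L² factor), `M_{Q1} = ‖Q(1)‖` (an unnamed
operator norm), `μ_{Q1}` (the modulus of `Q(1)†` by compactness), `C_Q ∝ √#Bond(d,m)` — and each now has a volume-free tree letter: this lineage's
`B9Thm311SmallFieldClosedUniform` §9 (γ₁, ε₃ before `m`), ne9-leaf-03's `B9Eq315QFlatNorm.norm_QtorusW_one_le`, ne9-leaf-04's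
`B9Eq315QFlatRightInverse.modulus_adjoint_QtorusW_one` and `B9Eq383QSemiLocal.norm_QtorusW_sub_flat_le_local`.  This file re-runs the owner's
proof with those five tokens and moves `∃ C_H C_G ε₅` in front of `∀ m`: the `L²` radii feeding `Support/NE9CurChartOfBackground.cur_chart_exists_
of_small_field` no longer depend on the volume (the transfer to the chart's Banach norms `NegSize`∕`Space115` is untouched and per lattice).

WHAT IS PROVED (sorry-free; 0 `def`; no inequality of the paper asserted as a hypothesis-free fact).
* §10 **`exists_H1_frakG_bound_of_small_field_uniform`**: `∃ C_H C_G ε₅ > 0, ∀ m, ∀ U` (E162 data, `‖U(b) − 1‖ ≤ ε ≤ ε₅`, `hRS`) `∀ hpos hQ`,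
  `‖H1LatticeK hpos hQ b‖ ≤ C_H‖b‖ ∧ ‖frakGLatticeK hpos hQ x‖ ≤ C_G‖x‖` — the owner's statement with the volume quantified INSIDE; proof = his,
  verbatim, on his per-field `norm_laplaceAofBackground_le` BY NAME.
MODEL / DECLARED READINGS.  (M1)/(M2) as (H2) (displayed: `hRS`, `M_φ`, `M_φ′`, `C_τ`, `a > 0`, `η ≠ 0`; ANY witnesses `hpos`, `hQ`).  (M3) NOT HERE:
the chart's Banach norms, decay, uniformity in the SPACING (print's Thms 3.1–3.4), the gauge step.
HONEST SCOPE.  [folklore] finite-dimensional bookkeeping — the OWNER's mechanism re-run with the leaves' volume-free letters; `C_H, C_G, ε₅` now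
numbers of `d, L, η, a, c₀, c₁, M_φ, M_φ′, C_τ` only; nothing of [B9] asserted; «NE9 ⇐ the named binders»; NE9 NOT PRINTED ∕ NOT PROVED; NOT summit
progress (cell pub-balaban: spine PROVED 0/9; rung (B)+1 finite T⁴ — NOT infinite volume, NOT mass gap, NOT Clay; HONEST DEPENDENCY: continuum YM
on T⁴ ⇐ BetaPertH ∧ nine spine estimates (0/9 proved); BetaPertH ⇐ (D1) ∧ (D4) ∧ CAP+tail; G-an2-4 gates asym, D1 and NE2/3/4).  Unit
`b2b-balaban-t4-ne9-formalise-leaf-03` (gen 59), INTENT I-ne9leaf03-g59-2 item (H2′), after the OWNER's first refusal; NEW file importing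
`B9Thm311SmallFieldClosedUniform`, `B9Eq3126H1Bound`, `B9Eq315QFlatRightInverse`; modifies nothing.  Net new unproved facts: 0.
-/

noncomputable section

open scoped InnerProductSpace ComplexConjugate BigOperators

namespace Literature.MathematicalPhysics.QuantumFieldTheory.Balaban1983to89.B9Eq3126H1BoundUniform

open B9Eq373DerivativeRemainderL2 (norm_adjoint_apply_le)
open B9Eq3126GreenLetters (norm_H1K_le norm_frakGLin_le adjoint_injective_of_modulus)

/-! ## §10 `H₁(U)`, `𝔊(U)` with `C_H, C_G, ε₅` independent of the volume -/

section Uniform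

open B4Sect5Torus (TSite)
open B9SectCLatticeCarrier (Bond)
open B7Prop1Explicit (U1 Wcx boxVec)
open B9Eq311L2Pairing (WL2)
open B9Eq319QprimeTorus (fineP)
open B11Eq103H1Complex (SiteL2K BondL2K covDerivL2K covDivL2K laplaceALatticeK H1LatticeK frakGLatticeK G1LatticeK KinvLatticeK hadj_adjoint
  adjoint_injective_of_surjective)
open B9Eq310HessianOperator (adTransportW principalOpK hessOp hessOp_apply curvOp)
open B9Eq310DeltaPrime (plaqHolU)
open B9Eq326OperatorAssembly (RofU)
open B9Eq315QTorus (perCfg cornerSite QtorusW laplaceAofBackground)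
open B9Eq315QTorusOnto (liftSite perSite_liftSite)
open B5Eq172FlatCoercivity (hU1_one hreg_one)
open B9Eq368ProjectionRemainder (norm_projR_le)
open B9Eq373DerivativeRemainderL2 (norm_covDerivL2K_le norm_covDivL2K_le)
open B9Eq384RemainderLetters (norm_adTransportW_sub_le)
open B9Eq383QSemiLocal (norm_QtorusW_sub_flat_le_local)
open B9Eq315QFlatNorm (norm_QtorusW_one_le)
open B9Eq315QFlatRightInverse (modulus_adjoint_QtorusW_one)
open B9Eq3126H1Bound (norm_laplaceAofBackground_le)
open B9Thm311SmallFieldClosedUniform (exists_coercive_laplaceA_of_small_field_uniform)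

variable {d : ℕ} (L : ℕ) [NeZero L] (hL : 1 ≤ L)
  {𝔸 : Type*} [NormedRing 𝔸] [NormedAlgebra ℂ 𝔸] [CompleteSpace 𝔸] [NormOneClass 𝔸] [StarRing 𝔸] [NormedStarGroup 𝔸] [StarModule ℂ 𝔸]
  {W : Type*} [NormedAddCommGroup W] [InnerProductSpace ℂ W] [FiniteDimensional ℂ W] (φ : W ≃ₗ[ℂ] 𝔸) {c₀ c₁ : ℝ} [Fact (0 < c₀)] [Fact (0 < c₁)]
set_option maxHeartbeats 400000 in
/-- **`H₁(U)` AND `𝔊(U)` BOUNDED WITH `C_H, C_G, ε₅` CHOSEN BEFORE THE VOLUME** — the OWNER's (H2) `B9Eq3126H1Bound.exists_H1_frakG_bound_of_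
small_field` with `∃ C_H C_G ε₅` in front of `∀ m`: his proof VERBATIM (constants `K_R`, `M_T`, `M_D`, `ε₅ = min ε₃ (min (1∕(K_R+1)) (min 1 (μ_{Q1}∕
(2C_Q+1))))`, the `norm_H1K_le` ∕ `norm_frakGLin_le` letters of `B9Eq3126GreenLetters`, his per-field `norm_laplaceAofBackground_le` BY NAME) with
the five volume-dependent tokens replaced by tree letters: `γ₁, ε₃` ← `B9Thm311SmallFieldClosedUniform.exists_coercive_laplaceA_of_small_field_uniform`;
`M_{Q1} := M_φ′M_φ√(c₁∕(c₀L^d))` ← ne9-leaf-03's `B9Eq315QFlatNorm.norm_QtorusW_one_le`; `μ_{Q1} := (√(c₀L^{d+2}∕c₁))⁻¹` ← ne9-leaf-04's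
`B9Eq315QFlatRightInverse.modulus_adjoint_QtorusW_one`; `C_Q := M_φ′M_φ√(2d·c₁∕c₀)·102(d+1)²L` ← ne9-leaf-04's `B9Eq383QSemiLocal.norm_QtorusW_sub_
flat_le_local`.  `L²` operator bounds only (the chart's Banach norms are NOT touched).
[cite: Balaban1985BackgroundPropagators, (3.126) p.420, (3.153) p.426, Thm 3.4 p.400, Thm 3.11 p.416; Balaban1985Variational, (45) p.285, (110)–(111) p.294] -/
theorem exists_H1_frakG_bound_of_small_field_uniform {η : ℝ} (hη : η ≠ 0) {a : ℝ} (ha : 0 < a) {Mφ Mφ' : ℝ} (hMφ : 0 ≤ Mφ) (hMφ' : 0 ≤ Mφ')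
    (hφ : ∀ w, ‖φ w‖ ≤ Mφ * ‖w‖) (hφ' : ∀ X, ‖φ.symm X‖ ≤ Mφ' * ‖X‖) (τ : 𝔸 →ₗ[ℂ] ℂ) {Cτ : ℝ} (hτ : ∀ X, ‖τ X‖ ≤ Cτ * ‖X‖) (hCτ : 0 ≤ Cτ) :
    ∃ CH CG ε₅ : ℝ, 0 < CH ∧ 0 < CG ∧ 0 < ε₅ ∧ ∀ (m : Fin d → ℕ) [∀ i, NeZero (fineP L m i)]
      (U : Bond d (fineP L m) → 𝔸ˣ) {α : ℝ} (hα1 : α ≤ 1 / 64)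
      (hU1 : ∀ (x : B7Prop1Explicit.Site d) (κ : Fin d), perCfg (fineP L m) U x κ ∈ U1 𝔸)
      (hreg : ∀ (y : TSite d m) (κ : Fin d) (r : Fin d → Fin L), ‖((Wcx L (perCfg (fineP L m) U) (cornerSite L y) κ (boxVec L r) : 𝔸ˣ) : 𝔸) - 1‖ ≤ α)
      {ε : ℝ}, 0 ≤ ε → ε ≤ ε₅ → (∀ b, ‖(U b : 𝔸) - 1‖ ≤ ε) →
      (∀ (b : Bond d (fineP L m)) (v u : W), ⟪adTransportW φ U b v, u⟫_ℂ = ⟪v, adTransportW φ (fun b => (U b)⁻¹) b u⟫_ℂ) →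
      ∀ (hpos : ∀ x : BondL2K ℂ d (fineP L m) c₀ W, x ≠ 0 →
          0 < RCLike.re ⟪x, laplaceAofBackground L m hL φ U hα1 hU1 hreg τ η (c₀ := c₀) (c₁ := c₁) a x⟫_ℂ)
        (hQ : Function.Surjective (QtorusW L m hL φ U hα1 hU1 hreg (c₀ := c₀) (c₁ := c₁))),
      (∀ b : BondL2K ℂ d m c₁ W, ‖H1LatticeK hpos hQ b‖ ≤ CH * ‖b‖) ∧
      (∀ x : BondL2K ℂ d (fineP L m) c₀ W, ‖frakGLatticeK hpos hQ x‖ ≤ CG * ‖x‖) := by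
  have hc₀ : 0 < c₀ := Fact.out
  have hc : conj ((η : ℂ))⁻¹ = ((η : ℂ))⁻¹ := by rw [map_inv₀, Complex.conj_ofReal]
  -- the uniform coercivity of `Δ_a(U)`, `γ₁, ε₃` chosen BEFORE the volume (`B9Thm311SmallFieldClosedUniform` §9)
  obtain ⟨γ₁, ε₃, hγ₁, hε₃, Hc⟩ :=
    exists_coercive_laplaceA_of_small_field_uniform L hL φ (c₀ := c₀) (c₁ := c₁) hη ha hMφ hMφ' hφ hφ' τ hτ hCτ
  -- the flat averaging: the volume-free bound `MQ1` (ne9-leaf-03 `B9Eq315QFlatNorm`) and modulus `μQ1` of `Q(1)†` (ne9-leaf-04 `B9Eq315QFlatRightInverse`)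
  obtain ⟨MQ1, hMQ1def⟩ : ∃ MQ1 : ℝ, MQ1 = Mφ' * Mφ * Real.sqrt (c₁ / (c₀ * (L : ℝ) ^ d)) := ⟨_, rfl⟩
  have hMQ1 : 0 ≤ MQ1 := by rw [hMQ1def]; positivity
  obtain ⟨μQ1, hμQ1def⟩ : ∃ μQ1 : ℝ, μQ1 = (Real.sqrt (c₀ * (L : ℝ) ^ (d + 2) / c₁))⁻¹ := ⟨_, rfl⟩
  have hc₁ : 0 < c₁ := Fact.out
  have hL0 : (0 : ℝ) < L := by exact_mod_cast Nat.pos_of_ne_zero (NeZero.ne L)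
  have hμQ1 : 0 < μQ1 := by rw [hμQ1def]; exact inv_pos.2 (Real.sqrt_pos.2 (by positivity))
  -- the constants
  obtain ⟨KR, hKRdef⟩ : ∃ KR : ℝ, KR = 2 * Mφ * Mφ' := ⟨_, rfl⟩
  have hKR : 0 ≤ KR := by rw [hKRdef]; positivity
  obtain ⟨CQ, hCQdef⟩ : ∃ CQ : ℝ, CQ = Mφ' * Mφ * Real.sqrt (2 * d * c₁ / c₀) * (102 * (d + 1) ^ 2 * L) := ⟨_, rfl⟩
  have hCQ : 0 ≤ CQ := by rw [hCQdef]; positivity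
  obtain ⟨MT, hMTdef⟩ : ∃ MT : ℝ, MT = 64 * d * ‖((η : ℂ))⁻¹‖ ^ 2 + 16 * ‖((η : ℂ))⁻¹‖ ^ 2 * d +
      32 * d * Cτ * Mφ ^ 2 * (|η| ^ d / c₀) * (‖((η : ℂ))⁻¹‖ ^ 2 * (4 * 1)) + (MQ1 + CQ) * (|a| * (MQ1 + CQ)) + 1 := ⟨_, rfl⟩
  have hMT0 : 0 < MT := by rw [hMTdef]; positivity
  obtain ⟨MD, hMDdef⟩ : ∃ MD : ℝ, MD = 2 * (1 + 1) * ‖((η : ℂ))⁻¹‖ * Real.sqrt d := ⟨_, rfl⟩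
  have hMD : 0 ≤ MD := by rw [hMDdef]; positivity
  refine ⟨γ₁⁻¹ * (MQ1 + CQ) * (γ₁ * (μQ1 / 2) ^ 2 / MT ^ 2)⁻¹ + 1,
    γ₁⁻¹ * (1 + (MQ1 + CQ) * (γ₁ * (μQ1 / 2) ^ 2 / MT ^ 2)⁻¹ * (MQ1 + CQ) * γ₁⁻¹ + MD * MD * γ₁⁻¹) + 1,
    min ε₃ (min (1 / (KR + 1)) (min 1 (μQ1 / (2 * CQ + 1)))), by positivity, by positivity, by positivity, ?_⟩
  intro m _ U α hα1 hU1 hreg ε hε hε₅ hUε hRS hpos hQs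
  -- the per-lattice letters at these constants
  have hQ1 : ∀ x : BondL2K ℂ d (fineP L m) c₀ W,
      ‖QtorusW L m hL φ (fun _ => 1) (show (0 : ℝ) ≤ 1 / 64 by norm_num) (hU1_one L m) (hreg_one L m) (c₀ := c₀) (c₁ := c₁) x‖ ≤ MQ1 * ‖x‖ :=
    fun x => by
      rw [hMQ1def]
      exact norm_QtorusW_one_le L m hL (show (0 : ℝ) ≤ 1 / 64 by norm_num) (hU1_one L m) (hreg_one L m) φ hMφ hφ hMφ' hφ' x
  have hQ1adj : ∀ y : BondL2K ℂ d m c₁ W, μQ1 * ‖y‖ ≤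
      ‖LinearMap.adjoint (QtorusW L m hL φ (fun _ => 1) (show (0 : ℝ) ≤ 1 / 64 by norm_num) (hU1_one L m) (hreg_one L m) (c₀ := c₀) (c₁ := c₁)) y‖ :=
    fun y => by
      rw [hμQ1def]
      exact modulus_adjoint_QtorusW_one L m hL (show (0 : ℝ) ≤ 1 / 64 by norm_num) (hU1_one L m) (hreg_one L m) φ (c₀ := c₀) (c₁ := c₁) y
  have hεε₃ : ε ≤ ε₃ := hε₅.trans (min_le_left _ _)
  have hε1' : ε ≤ 1 / (KR + 1) := hε₅.trans ((min_le_right _ _).trans (min_le_left _ _))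
  have hε1 : ε ≤ 1 := hε₅.trans ((min_le_right _ _).trans ((min_le_right _ _).trans (min_le_left _ _)))
  have hεμ : ε ≤ μQ1 / (2 * CQ + 1) := hε₅.trans ((min_le_right _ _).trans ((min_le_right _ _).trans (min_le_right _ _)))
  have hεR1 : 2 * Mφ * Mφ' * ε ≤ 1 := by
    rw [← hKRdef]
    refine (mul_le_mul_of_nonneg_left hε1' hKR).trans ?_
    rw [mul_one_div, div_le_one (by positivity)]; linarith
  have hδQ : CQ * ε ≤ μQ1 / 2 := by
    have h1 : CQ * ε ≤ CQ * (μQ1 / (2 * CQ + 1)) := mul_le_mul_of_nonneg_left hεμ hCQ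
    have h2 : CQ * (μQ1 / (2 * CQ + 1)) ≤ μQ1 / 2 := by
      rw [mul_div_assoc', div_le_div_iff₀ (by positivity) (by norm_num)]; nlinarith
    exact h1.trans h2
  -- `Q(U)`: operator bound and modulus of its adjoint
  have hQdiff : ∀ x : BondL2K ℂ d (fineP L m) c₀ W, ‖QtorusW L m hL φ U hα1 hU1 hreg (c₁ := c₁) x -
      QtorusW L m hL φ (fun _ => 1) (show (0 : ℝ) ≤ 1 / 64 by norm_num) (hU1_one L m) (hreg_one L m) (c₁ := c₁) x‖ ≤ CQ * ε * ‖x‖ := fun x => by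
    refine (norm_QtorusW_sub_flat_le_local L m hL U hα1 hU1 hreg (show (0 : ℝ) ≤ 1 / 64 by norm_num) (hU1_one L m) (hreg_one L m) hε hUε φ
      hMφ hφ hMφ' hφ' x).trans (le_of_eq ?_)
    rw [hCQdef]; ring
  have hQU : ∀ x : BondL2K ℂ d (fineP L m) c₀ W, ‖QtorusW L m hL φ U hα1 hU1 hreg (c₀ := c₀) (c₁ := c₁) x‖ ≤ (MQ1 + CQ) * ‖x‖ := fun x => by
    have h1 := hQ1 x
    have h2 := hQdiff x
    have h3 := norm_le_insert' (QtorusW L m hL φ U hα1 hU1 hreg (c₀ := c₀) (c₁ := c₁) x)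
      (QtorusW L m hL φ (fun _ => 1) (show (0 : ℝ) ≤ 1 / 64 by norm_num) (hU1_one L m) (hreg_one L m) (c₀ := c₀) (c₁ := c₁) x)
    have h4 : CQ * ε * ‖x‖ ≤ CQ * ‖x‖ := mul_le_mul_of_nonneg_right (mul_le_of_le_one_right hCQ hε1) (norm_nonneg x)
    linarith
  have hQUadj : ∀ y : BondL2K ℂ d m c₁ W, μQ1 / 2 * ‖y‖ ≤ ‖LinearMap.adjoint (QtorusW L m hL φ U hα1 hU1 hreg (c₀ := c₀) (c₁ := c₁)) y‖ := fun y => by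
    have h1 := hQ1adj y
    have h2 : ‖LinearMap.adjoint (QtorusW L m hL φ U hα1 hU1 hreg (c₀ := c₀) (c₁ := c₁) -
        QtorusW L m hL φ (fun _ => 1) (show (0 : ℝ) ≤ 1 / 64 by norm_num) (hU1_one L m) (hreg_one L m) (c₀ := c₀) (c₁ := c₁)) y‖ ≤ CQ * ε * ‖y‖ :=
      norm_adjoint_apply_le _ (by positivity) (fun x => by rw [LinearMap.sub_apply]; exact hQdiff x) y
    rw [map_sub, LinearMap.sub_apply] at h2
    have h3 := norm_le_insert (LinearMap.adjoint (QtorusW L m hL φ U hα1 hU1 hreg (c₀ := c₀) (c₁ := c₁)) y)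
      (LinearMap.adjoint (QtorusW L m hL φ (fun _ => 1) (show (0 : ℝ) ≤ 1 / 64 by norm_num) (hU1_one L m) (hreg_one L m) (c₀ := c₀) (c₁ := c₁)) y)
    have h4 : CQ * ε * ‖y‖ ≤ μQ1 / 2 * ‖y‖ := mul_le_mul_of_nonneg_right hδQ (norm_nonneg _)
    linarith
  -- the operator bound of `Δ_a(U)` and its letters in the `laplaceAK` form
  have hMTU := norm_laplaceAofBackground_le L m hL φ hMφ hMφ' hφ hφ' τ hτ hCτ (η := η) a U hα1 hU1 hreg hε hεR1 hUε hRS (by positivity) hQU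
  have hMT : ∀ x : BondL2K ℂ d (fineP L m) c₀ W,
      ‖B11Eq103H1Complex.laplaceAK (hessOp φ η U τ) (covDerivL2K ℂ c₀ ((η : ℂ))⁻¹ (adTransportW φ U)) (RofU L m φ η U)
        (covDivL2K ℂ c₀ ((η : ℂ))⁻¹ (adTransportW φ fun b => (U b)⁻¹)) (QtorusW L m hL φ U hα1 hU1 hreg (c₀ := c₀) (c₁ := c₁))
        (LinearMap.adjoint (QtorusW L m hL φ U hα1 hU1 hreg (c₀ := c₀) (c₁ := c₁))) (RCLike.ofReal a) x‖ ≤ MT * ‖x‖ := fun x => by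
    refine (hMTU x).trans (mul_le_mul_of_nonneg_right ?_ (norm_nonneg _))
    rw [hMTdef]
    have h1 : 32 * d * Cτ * Mφ ^ 2 * (|η| ^ d / c₀) * (‖((η : ℂ))⁻¹‖ ^ 2 * (4 * ε)) ≤
        32 * d * Cτ * Mφ ^ 2 * (|η| ^ d / c₀) * (‖((η : ℂ))⁻¹‖ ^ 2 * (4 * 1)) := by gcongr
    linarith
  have hcoer : ∀ x : BondL2K ℂ d (fineP L m) c₀ W, γ₁ * ‖x‖ ^ 2 ≤ RCLike.re ⟪x,
      B11Eq103H1Complex.laplaceAK (hessOp φ η U τ) (covDerivL2K ℂ c₀ ((η : ℂ))⁻¹ (adTransportW φ U)) (RofU L m φ η U)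
        (covDivL2K ℂ c₀ ((η : ℂ))⁻¹ (adTransportW φ fun b => (U b)⁻¹)) (QtorusW L m hL φ U hα1 hU1 hreg (c₀ := c₀) (c₁ := c₁))
        (LinearMap.adjoint (QtorusW L m hL φ U hα1 hU1 hreg (c₀ := c₀) (c₁ := c₁))) (RCLike.ofReal a) x⟫_ℂ :=
    fun x => Hc m U hα1 hU1 hreg hε hεε₃ hUε hRS x
  have hpos' : ∀ x : BondL2K ℂ d (fineP L m) c₀ W, x ≠ 0 → 0 < RCLike.re ⟪x,
      B11Eq103H1Complex.laplaceAK (hessOp φ η U τ) (covDerivL2K ℂ c₀ ((η : ℂ))⁻¹ (adTransportW φ U)) (RofU L m φ η U)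
        (covDivL2K ℂ c₀ ((η : ℂ))⁻¹ (adTransportW φ fun b => (U b)⁻¹)) (QtorusW L m hL φ U hα1 hU1 hreg (c₀ := c₀) (c₁ := c₁))
        (LinearMap.adjoint (QtorusW L m hL φ U hα1 hU1 hreg (c₀ := c₀) (c₁ := c₁))) (RCLike.ofReal a) x⟫_ℂ := hpos
  have hμ2 : 0 < μQ1 / 2 := by positivity
  have hD : ∀ s : SiteL2K ℂ d (fineP L m) c₀ W, ‖covDerivL2K ℂ c₀ ((η : ℂ))⁻¹ (adTransportW φ U) s‖ ≤ MD * ‖s‖ := fun s => by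
    rw [hMDdef]
    have hUb' : ∀ b : Bond d (fineP L m), U b ∈ U1 𝔸 := fun b => by
      obtain ⟨y, κ⟩ := b
      have h := hU1 (liftSite y) κ
      rwa [B9Eq315QTorus.perCfg_apply, perSite_liftSite] at h
    exact norm_covDerivL2K_le _ zero_le_one (fun b w => (norm_adTransportW_sub_le φ hφ hφ' hMφ' U b (hUb' b) (hUε b) w).trans
      (mul_le_mul_of_nonneg_right hεR1 (norm_nonneg _))) s
  have hDs : ∀ x : BondL2K ℂ d (fineP L m) c₀ W, ‖covDivL2K ℂ c₀ ((η : ℂ))⁻¹ (adTransportW φ fun b => (U b)⁻¹) x‖ ≤ MD * ‖x‖ := fun x => by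
    rw [hMDdef]
    have hUb' : ∀ b : Bond d (fineP L m), U b ∈ U1 𝔸 := fun b => by
      obtain ⟨y, κ⟩ := b
      have h := hU1 (liftSite y) κ
      rwa [B9Eq315QTorus.perCfg_apply, perSite_liftSite] at h
    exact norm_covDivL2K_le _ hc zero_le_one (fun b w => (norm_adTransportW_sub_le φ hφ hφ' hMφ' U b (hUb' b) (hUε b) w).trans
      (mul_le_mul_of_nonneg_right hεR1 (norm_nonneg _))) hRS x
  have hRle : ∀ s : SiteL2K ℂ d (fineP L m) c₀ W, ‖RofU L m φ η U s‖ ≤ ‖s‖ := fun s => by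
    unfold RofU B11Eq103H1Complex.RLatticeK; exact norm_projR_le _ _ s
  refine ⟨fun b => ?_, fun x => ?_⟩
  · have h := norm_H1K_le (𝕜 := ℂ) (E := BondL2K ℂ d (fineP L m) c₀ W) (F := BondL2K ℂ d m c₁ W) (S := SiteL2K ℂ d (fineP L m) c₀ W)
      (Δ := hessOp φ η U τ (c₀ := c₀)) (D := covDerivL2K ℂ c₀ ((η : ℂ))⁻¹ (adTransportW φ U)) (R := RofU L m φ η U (c₀ := c₀))
      (Dstar := covDivL2K ℂ c₀ ((η : ℂ))⁻¹ (adTransportW φ fun b => (U b)⁻¹)) (Q := QtorusW L m hL φ U hα1 hU1 hreg (c₀ := c₀) (c₁ := c₁))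
      (a := RCLike.ofReal a) (γ := γ₁) (MT := MT) (MQ := MQ1 + CQ) (μQ := μQ1 / 2) hγ₁ hcoer hMT hpos' (by positivity) hμ2 hQU hQUadj
      (fun x' y' => (LinearMap.adjoint_inner_right _ x' y').symm) (adjoint_injective_of_modulus hμ2 hQUadj) hMT0 b
    have h' : ‖H1LatticeK hpos hQs b‖ ≤ γ₁⁻¹ * (MQ1 + CQ) * (γ₁ * (μQ1 / 2) ^ 2 / MT ^ 2)⁻¹ * ‖b‖ := h
    exact h'.trans (mul_le_mul_of_nonneg_right (le_add_of_nonneg_right zero_le_one) (norm_nonneg b))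
  · have h := norm_frakGLin_le (𝕜 := ℂ) (E := BondL2K ℂ d (fineP L m) c₀ W) (F := BondL2K ℂ d m c₁ W) (S := SiteL2K ℂ d (fineP L m) c₀ W)
      (Δ := hessOp φ η U τ (c₀ := c₀)) (D := covDerivL2K ℂ c₀ ((η : ℂ))⁻¹ (adTransportW φ U)) (R := RofU L m φ η U (c₀ := c₀))
      (Dstar := covDivL2K ℂ c₀ ((η : ℂ))⁻¹ (adTransportW φ fun b => (U b)⁻¹)) (Q := QtorusW L m hL φ U hα1 hU1 hreg (c₀ := c₀) (c₁ := c₁))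
      (a := RCLike.ofReal a) (γ := γ₁) (MT := MT) (MQ := MQ1 + CQ) (μQ := μQ1 / 2) (MD := MD) hγ₁ hcoer hMT hpos' (by positivity) hμ2 hQU hQUadj
      (fun x' y' => (LinearMap.adjoint_inner_right _ x' y').symm) (adjoint_injective_of_modulus hμ2 hQUadj) hMD hD hDs hRle hMT0 x
    have h' : ‖frakGLatticeK hpos hQs x‖ ≤ γ₁⁻¹ * (1 + (MQ1 + CQ) * (γ₁ * (μQ1 / 2) ^ 2 / MT ^ 2)⁻¹ * (MQ1 + CQ) * γ₁⁻¹ + MD * MD * γ₁⁻¹) * ‖x‖ := h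
    exact h'.trans (mul_le_mul_of_nonneg_right (le_add_of_nonneg_right zero_le_one) (norm_nonneg x))

end Uniform

end Literature.MathematicalPhysics.QuantumFieldTheory.Balaban1983to89.B9Eq3126H1BoundUniform

end
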